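import Summits.BirchSwinnertonDyer.BirchSwinnertonDyer.Theorems.GenusKolyvaginAtTwoGenusPrimitiveSupplyAtTwoTwistLocalConditionSigned
import Literature.NumberTheory.EllipticCurves.KramerDescentSelmerTwoSpanProofs
import Literature.NumberTheory.EllipticCurves.UnramifiedPrimeTwist
import HarnessLib

/-!
# Route `GenusKolyvaginAtTwo`, crux #2 `GenusPrimitiveSupplyAtTwo` (stmt-BirchSwinnertonDyer-22136):
# THE MODEL ↔ `PrimeTwist` DICTIONARY at `p = 2` — Mazur–Rubin's twist `A_χ` of `E` by the quadratic character of `K(√d)` IS the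
# quadratic twist `E^{(d)}`: `Γ_K`-equivariantly `Wd(K̄) ≅ A_χ(K̄)` for ANY model `Wd` of `E^{(d)}`, compatibly with `Wd[2] ≅ W[2] = A_χ[𝔓]`
# and with every localisation, so `H¹(K, Wd[2]) ≅ H¹(K, W[2])` carries the `2`-Selmer local condition of `Wd` at ANY `K`-field onto the
# `𝔓`-Selmer local condition of `A_χ` and `H¹(K, Wd) ≅ H¹(K, A_χ)` carries the local kernels onto each other
# (REF1 §41's `F1Sign2.TwistModelDictionaryAtTwo`, core over any field with `2 ≠ 0`)

Width seat `bsd-line-gk2-p5` g15 (cell `bsd-f1-sign2`, SUPPLY lineage of crux 22136), file 39 of the series; sequel of files 23/26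
`…TwistLocalCondition[Signed]` (gk2-p5 g8: the untwisting chain over `K̄` and over `K̄_E` with its sign rules).
THEOREMS ONLY (no definition, no named fact, no `sorry`); helper `--supports stmt-BirchSwinnertonDyer-22136`; no item is closed;
BSD is not proved by any of this.

WHAT. For a field `K` with `2 ≠ 0`, `d ∈ K^×`, ANY model `Wd = C • W^{(d)}` of the quadratic twist, and a character `χ : Γ_K → ZMod 2`
with `χ σ = 1 ↔ σ√d = √d` (the character of `K(√d)/K`; `χ = 1` if `d ∈ K^{×2}`, when `A_χ`'s conditions are `E`'s):
* §173 `exists_addEquiv_points_two` — for `p = 2` the Mazur–Rubin twist `PrimeTwist.points χ M = {f : ZMod 2 → M | f 0 + f 1 = 0}` of ANY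
  abelian group `M` is `M` itself via `f ↦ f 0` (inverse: the anti-diagonal `m ↦ (m, -m)`), stated as an existence with its evaluation
  laws (no definition is introduced).
* §174 `addEquiv_points_two_smul_of_sign` — under the anti-diagonal the diagonal action `(γ • f) i = γ • f (i - χ γ)` (MR Prop. 3.1)
  becomes the SIGN-TWISTED action `γ ⋆ m = χ(γ) · (γ • m)`; so an additive map that is `Γ`-equivariant UP TO THE SIGN `χ`
  (Silverman X.5 Cor. 5.4: the untwisting `(x,y) ↦ (x/θ², y/θ³)` with `σθ = χ(σ)θ`) becomes `Γ`-EQUIVARIANT ON THE NOSE into the twist —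
  «for `p = 2`, `A_χ` is the quadratic twist».
* §175 `closureEmb_resGal_smul_geomSqrt` — `ι(σ√d) = τ ι(√d)` for `σ = resGal τ`: the local character `χ ∘ resGal` is read off `ι(√d)`.
* §176 **`exists_primeTwistModel_dictionary`** — there are a `Γ_K`-equivariant `ψ : Wd[2] ≃+ W[2]` and a `Γ_K`-EQUIVARIANT
  `Φ : Wd(K̄) ≃+ A_χ(K̄) = PrimeTwist.geomModule W χ`, with `Φ|_{Wd[2]} = constEmb ∘ ψ` (MR Prop. 4.1: `E[2] = A_χ[𝔓]`), such that for
  EVERY `K`-field `E` (no hypothesis on the place): `x ∈ Wd.selmerLocalKer E 2 ↔ h1Equiv ψ x ∈ PrimeTwist.selmerLocalKer W χ E` and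
  `c ∈ Wd.localRestrictionKer E ↔ h1Equiv Φ c ∈ PrimeTwist.localKer W χ E`.
Sequel (file 40 `…PrimeTwistModelSelmer`): over a number field `Sel₂(Wd) ≅ Sel_𝔓(A_χ)`, `Ш(Wd) ≅ Ш(A_χ)`, `#Sel_𝔓(A_χ) = #Sel₂(Wd)`; over `ℚ`
with `F1Sign2.IsQuadraticCharacterOf`: `TwistModelDictionaryAtTwo` (1)–(2), U′ `OddBranchShaIndexTwoInTwistSelmerAtTwo`, the UP decision.

Honest framing: KNOWN in print (Mazur–Rubin 2007 §3 «for `p = 2`, `A_L` is the quadratic twist of `E` by `L/K`», Prop. 3.1, Thm. 3.4(iii),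
Prop. 4.1, Def. 4.3; Silverman X.2 Prop. 2.4 / X.5 Cor. 5.4); kernel-new bookkeeping; beyond-print theorem: no. Crux 22136 stays OPEN exactly
at (U) 24947 ∧ (CONV₂) 19220/24948. BSD is not proved by any of this.

References: [MazurRubin2007] §3, Prop. 3.1, Thm. 3.4(iii), Prop. 4.1, Remark 4.2, Def. 4.3, §5; [SilvermanAEC2009] X.2 Prop. 2.4,
X.5 Cor. 5.4, X.§4; [MazurRubin2010] Remark 2.4.
-/

set_option linter.dupNamespace false -- tree convention: `Summit.BirchSwinnertonDyer.BirchSwinnertonDyer.Theorems` (summit = sub-problem)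
set_option autoImplicit false

noncomputable section

open scoped Classical

namespace Summit.BirchSwinnertonDyer.BirchSwinnertonDyer.Theorems.GenusKolyArch

open WeierstrassCurve Field
open Literature.NumberTheory.EllipticCurves
open Literature.NumberTheory.EllipticCurves.KramerTwoDescent (zmod_two_cases)
open Summit.BirchSwinnertonDyer.BirchSwinnertonDyer.Theorems.GenusKolyTwistLocal

universe u

/-! ## §173 For `p = 2` the Mazur–Rubin twist of `M` is `M`: the anti-diagonal -/

section AntiDiagonal

variable {Γ : Type*} [Group Γ] (χ : Γ →* Multiplicative (ZMod 2)) (M : Type*) [AddCommGroup M]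

/-- Sums over `ZMod 2 = Fin 2`. [folklore] -/
theorem sum_zmod_two_eq (g : ZMod 2 → M) : ∑ i, g i = g 0 + g 1 :=
  Fin.sum_univ_two g

/-- `χ γ` read additively is `0` iff `χ γ = 1`. [folklore] -/
theorem expo_eq_zero_iff (γ : Γ) : PrimeTwist.ResPoints.expo χ γ = 0 ↔ χ γ = 1 := by
  simp [PrimeTwist.ResPoints.expo]

/-- `χ γ ≠ 1` iff `χ γ` read additively is `1` (`p = 2`). [folklore] -/
theorem expo_eq_one_of_ne_one (γ : Γ) (h : χ γ ≠ 1) : PrimeTwist.ResPoints.expo χ γ = 1 := by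
  rcases zmod_two_cases (PrimeTwist.ResPoints.expo χ γ) with h0 | h1
  · exact absurd ((expo_eq_zero_iff χ γ).mp h0) h
  · exact h1

/-- In the twist for `p = 2`, `f 1 = - f 0`. [cite: MazurRubin2007, Thm 3.4(iii)] -/
theorem points_two_apply_one (f : PrimeTwist.points χ M) :
    (f : PrimeTwist.ResPoints χ M) 1 = -(f : PrimeTwist.ResPoints χ M) 0 := by
  have h := (PrimeTwist.mem_points_iff χ M _).mp f.2
  rw [sum_zmod_two_eq] at h
  exact eq_neg_of_add_eq_zero_right h

/-- **For `p = 2` the Mazur–Rubin twist `A_χ(X) = {f : Gal(L/K) → E(X) | f 0 + f 1 = 0}` of an abelian group `M` is `M`**: there is an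
additive isomorphism `e : M ≃+ PrimeTwist.points χ M` with `(e m) 0 = m`, `(e m) 1 = -m`, `e⁻¹ f = f 0` (the anti-diagonal; as a bare
group the twist forgets `χ`, which enters only through the action, §174). [cite: MazurRubin2007, §3 and Thm 3.4(iii)] -/
theorem exists_addEquiv_points_two :
    ∃ e : M ≃+ ↥(PrimeTwist.points χ M),
      (∀ m, ((e m : PrimeTwist.points χ M) : PrimeTwist.ResPoints χ M) 0 = m) ∧
      (∀ m, ((e m : PrimeTwist.points χ M) : PrimeTwist.ResPoints χ M) 1 = -m) ∧
      (∀ f, e.symm f = (f : PrimeTwist.ResPoints χ M) 0) := by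
  have hmem : ∀ m : M, (⟨fun i ↦ if i = 0 then m else -m⟩ : PrimeTwist.ResPoints χ M) ∈
      PrimeTwist.points χ M := by
    intro m
    rw [PrimeTwist.mem_points_iff, sum_zmod_two_eq]
    simp
  let e : M ≃+ ↥(PrimeTwist.points χ M) :=
    { toFun := fun m ↦ ⟨_, hmem m⟩
      invFun := fun f ↦ (f : PrimeTwist.ResPoints χ M) 0
      left_inv := fun m ↦ by simp
      right_inv := fun f ↦ by
        apply Subtype.ext
        ext i
        rcases zmod_two_cases i with rfl | rfl
        · simp
        · simp only [PrimeTwist.ResPoints.mk_apply, one_ne_zero, if_false]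
          exact (points_two_apply_one χ M f).symm
      map_add' := fun a b ↦ by
        apply Subtype.ext
        ext i
        rcases zmod_two_cases i with rfl | rfl
        · simp
        · simp only [AddSubgroup.coe_add, PrimeTwist.ResPoints.add_apply, PrimeTwist.ResPoints.mk_apply,
            one_ne_zero, if_false, neg_add] }
  refine ⟨e, fun m ↦ by simp [e], fun m ↦ ?_, fun f ↦ rfl⟩
  change ((⟨fun i ↦ if i = 0 then m else -m⟩ : PrimeTwist.ResPoints χ M)) 1 = -m
  simp

/-! ## §174 The twisted action: sign-equivariant maps become equivariant -/

variable {χ M} [DistribMulAction Γ M] {N : Type*} [AddCommGroup N] [DistribMulAction Γ N]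

/-- **Under the anti-diagonal, the diagonal action on the twist is the SIGN-TWISTED action on `M`; so a `χ`-sign-equivariant additive map
`g : N → M` (`g (γ • n) = γ • g n` if `χ γ = 1`, `= -(γ • g n)` if `χ γ ≠ 1`) followed by `e` is `Γ`-EQUIVARIANT into `A_χ`.**
(MR Prop. 3.1 / Thm. 3.4(iii): `(γ • f) i = γ • f (i - χ γ)`; for `p = 2` this swaps the two coordinates `m, -m` exactly when `χ γ ≠ 1`.)
[cite: MazurRubin2007, Prop 3.1 and Thm 3.4(iii)] -/
theorem addEquiv_points_two_smul_of_sign (e : M ≃+ ↥(PrimeTwist.points χ M))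
    (he0 : ∀ m, ((e m : PrimeTwist.points χ M) : PrimeTwist.ResPoints χ M) 0 = m)
    (he1 : ∀ m, ((e m : PrimeTwist.points χ M) : PrimeTwist.ResPoints χ M) 1 = -m)
    (g : N → M) (hfix : ∀ (γ : Γ) (n : N), χ γ = 1 → g (γ • n) = γ • g n)
    (hneg : ∀ (γ : Γ) (n : N), χ γ ≠ 1 → g (γ • n) = -(γ • g n)) (γ : Γ) (n : N) :
    e (g (γ • n)) = γ • e (g n) := by
  apply Subtype.ext
  ext i
  rw [PrimeTwist.points.coe_smul, PrimeTwist.ResPoints.smul_apply']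
  by_cases hγ : χ γ = 1
  · rw [(expo_eq_zero_iff χ γ).mpr hγ, sub_zero]
    rcases zmod_two_cases i with rfl | rfl
    · rw [he0, he0, hfix γ n hγ]
    · rw [he1, he1, hfix γ n hγ, smul_neg]
  · rw [expo_eq_one_of_ne_one χ γ hγ]
    rcases zmod_two_cases i with rfl | rfl
    · rw [he0, zero_sub, ZMod.neg_eq_self_mod_two, he1, hneg γ n hγ, smul_neg]
    · rw [he1, sub_self, he0, hneg γ n hγ, neg_neg]

end AntiDiagonal

/-! ## §175 The local character is read off `ι(√d)` -/

section LocalChar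

variable {K : Type u} [Field K] {d : K} (E : Type u) [Field E] [Algebra K E]

/-- `ι(σ√d) = τ ι(√d)` for `σ = resGal τ` (the chosen `K̄ → K̄_E` intertwines `resGal τ` and `τ`). [folklore] -/
theorem closureEmb_resGal_smul_geomSqrt (τ : absoluteGaloisGroup E) :
    closureEmb (K := K) E (resGal (K := K) E τ • geomSqrt d) =
      (show AlgebraicClosure E ≃ₐ[E] AlgebraicClosure E from τ) (closureEmb (K := K) E (geomSqrt d)) :=
  apply_resGalAuxOfEmb_apply (closureEmb (K := K) E) τ (geomSqrt d)

end LocalChar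

/-! ## §176 The dictionary: `Wd(K̄) ≅ A_χ(K̄)` equivariantly, compatibly with `Wd[2] ≅ W[2] = A_χ[𝔓]` and with every localisation -/

section Main

variable {K : Type u} [Field K] [NeZero (2 : K)]

/-- **THE MODEL ↔ `PrimeTwist` DICTIONARY (core).** Let `K` be a field with `2 ≠ 0`, `d ∈ K^×`, `Wd = C • W^{(d)}` ANY model of the
quadratic twist, and `χ : Γ_K → ZMod 2` a character with `χ σ = 1 ↔ σ√d = √d` (the character of `K(√d)/K`; `χ = 1` if `d ∈ K^{×2}`).
Then there are a `Γ_K`-equivariant `ψ : Wd[2] ≃+ W[2]` (Mazur–Rubin 2010 Remark 2.4) and a `Γ_K`-EQUIVARIANT `Φ : Wd(K̄) ≃+ A_χ(K̄)`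
(Silverman's untwisting `(x,y) ↦ (x/θ², y/θ³)` — equivariant only up to the sign `χ` — followed by the anti-diagonal of §173, which absorbs
the sign into Mazur–Rubin's diagonal action: «for `p = 2`, `A_χ` is the quadratic twist»), with `Φ = constEmb ∘ ψ` on `Wd[2]`
(MR Prop. 4.1 `E[2] = A_χ[𝔓]`), such that at EVERY `K`-field `E` (no hypothesis on the place):
(i) `x ∈ H¹(K, Wd[2])` satisfies `Wd`'s local `2`-Selmer condition at `E` iff `h1Equiv ψ x` satisfies the `𝔓`-Selmer condition of `A_χ`;
(ii) `c ∈ H¹(K, Wd)` dies in `H¹(E, Wd)` iff `h1Equiv Φ c` dies in `H¹(E, A_χ)`.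
Proof: the same untwisting over `K̄_E` (with `ι(√d)`) is `Γ_E`-equivariant up to the LOCAL character `χ ∘ resGal` (§175), so its
anti-diagonal is `Γ_E`-equivariant into `A_χ(K̄_E)`, and both squares with the maps on points along `ι` commute on the nose (file 23 §4);
`mem_resKer_iff_h1Equiv_mem` does the rest. [cite: MazurRubin2007, §3, Prop 4.1, Def 4.3 and §5] [cite: SilvermanAEC2009, X.5 Cor. 5.4, X.§4] -/
theorem exists_primeTwistModel_dictionary (W : WeierstrassCurve K) {d : K} (hd : d ≠ 0)
    {Wd : WeierstrassCurve K} {C : VariableChange K} (hWd : C • W.quadraticTwist d = Wd)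
    (χ : absoluteGaloisGroup K →ₜ* Multiplicative (ZMod 2))
    (hχ : ∀ σ : absoluteGaloisGroup K, χ σ = 1 ↔ σ • geomSqrt d = geomSqrt d) :
    ∃ (ψ : geomTorsion Wd ((2 : ℕ) : ℤ) ≃+ geomTorsion W ((2 : ℕ) : ℤ))
      (hψ : ∀ (g : absoluteGaloisGroup K) (t : geomTorsion Wd ((2 : ℕ) : ℤ)), ψ (g • t) = g • ψ t)
      (Φ : geomPoints Wd ≃+ PrimeTwist.geomModule W χ)
      (hΦ : ∀ (g : absoluteGaloisGroup K) (P : geomPoints Wd), Φ (g • P) = g • Φ P),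
      (∀ t : geomTorsion Wd ((2 : ℕ) : ℤ), Φ (t : geomPoints Wd) =
          PrimeTwist.constEmb (χ : absoluteGaloisGroup K →* Multiplicative (ZMod 2)) W.geomPoints (ψ t)) ∧
      ∀ (E : Type u) [Field E] [Algebra K E],
        (∀ x : Wd.galH1Torsion ((2 : ℕ) : ℤ),
          x ∈ Wd.selmerLocalKer E ((2 : ℕ) : ℤ) ↔ h1Equiv ψ hψ x ∈ PrimeTwist.selmerLocalKer W χ E) ∧
        (∀ c : Wd.galH1, c ∈ Wd.localRestrictionKer E ↔ h1Equiv Φ hΦ c ∈ PrimeTwist.localKer W χ E) := by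
  letI : Invertible (2 : K) := invertibleOfNonzero two_ne_zero
  set C₀ : VariableChange K := W.toCharNeTwoNF with hC₀
  set V : WeierstrassCurve K := C₀ • W with hVdef
  haveI : V.IsCharNeTwoNF := by rw [hVdef, hC₀]; infer_instance
  have hV : C₀ • W = V := rfl
  have hVW : W.quadraticTwist d = V.quadraticTwist d := by
    rw [hVdef, quadraticTwist_smul]
    have h1 : (⟨C₀.u, d * C₀.r, 0, 0⟩ : VariableChange K) = 1 := by
      simp only [hC₀, toCharNeTwoNF, mul_zero]
      rfl
    rw [h1, one_smul]
  set χ' : absoluteGaloisGroup K →* Multiplicative (ZMod 2) := (χ : absoluteGaloisGroup K →* Multiplicative (ZMod 2)) with hχ'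
  -- the global untwisting `Wd(K̄) ≃+ W(K̄)`, `Γ_K`-equivariant up to the sign `χ`
  set eG : geomPoints Wd ≃+ geomPoints W :=
    (((twistPointsIso hWd).symm.trans (geomPointsCongr hVW)).trans (untwistEquiv V hd)).trans
      (twistPointsIso hV).symm with heG
  have hfixG : ∀ (g : absoluteGaloisGroup K) (Q : geomPoints Wd), χ' g = 1 → eG (g • Q) = g • eG Q :=
    fun g Q hg ↦ untwistChain_smul_of_eq hd hWd hV hVW g ((hχ g).mp hg) Q
  have hnegG : ∀ (g : absoluteGaloisGroup K) (Q : geomPoints Wd), χ' g ≠ 1 → eG (g • Q) = -(g • eG Q) := by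
    intro g Q hg
    rcases map_geomSqrt (absoluteGaloisGroup.toAlgEquiv K g) d with h | h
    · exact absurd ((hχ g).mpr h) hg
    · exact untwistChain_smul_of_eq_neg hd hWd hV hVW g h Q
  have hsign : ∀ (g : absoluteGaloisGroup K) (Q : geomPoints Wd),
      eG (g • Q) = g • eG Q ∨ eG (g • Q) = -(g • eG Q) := fun g Q ↦ by
    by_cases hg : χ' g = 1
    · exact Or.inl (hfixG g Q hg)
    · exact Or.inr (hnegG g Q hg)
  obtain ⟨ψ, hψ, hψe⟩ := exists_addEquiv_geomTorsion_two_of_sign eG hsign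
  -- the anti-diagonal into `A_χ(K̄)` and the equivariant `Φ`
  obtain ⟨adG, hadG0, hadG1, -⟩ := exists_addEquiv_points_two χ' W.geomPoints
  set Φ : geomPoints Wd ≃+ PrimeTwist.geomModule W χ := eG.trans adG with hΦdef
  have hΦ : ∀ (g : absoluteGaloisGroup K) (P : geomPoints Wd), Φ (g • P) = g • Φ P := fun g P ↦
    addEquiv_points_two_smul_of_sign adG hadG0 hadG1 eG hfixG hnegG g P
  -- `2`-torsion points are their own negatives
  have hneg2 : ∀ t : geomTorsion Wd ((2 : ℕ) : ℤ), -(eG (t : geomPoints Wd)) = eG (t : geomPoints Wd) := by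
    intro t
    have h2 : (2 : ℤ) • eG (t : geomPoints Wd) = 0 := by
      have h := congrArg eG ((mem_geomTorsion_iff Wd ((2 : ℕ) : ℤ) _).mp t.2)
      rw [map_zsmul, map_zero] at h
      exact h
    rw [two_zsmul] at h2
    exact neg_eq_of_add_eq_zero_left h2
  refine ⟨ψ, hψ, Φ, hΦ, fun t ↦ ?_, fun E _ _ ↦ ?_⟩
  · -- `Φ = constEmb ∘ ψ` on `Wd[2]`
    apply Subtype.ext
    ext i
    rw [PrimeTwist.constEmb_apply, hψe t]
    rcases zmod_two_cases i with rfl | rfl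
    · exact hadG0 _
    · rw [show ((Φ (t : geomPoints Wd) : PrimeTwist.geomModule W χ) : PrimeTwist.ResPoints χ' W.geomPoints) 1 =
          -(eG (t : geomPoints Wd)) from hadG1 _, hneg2 t]
  -- the local untwisting `Wd(K̄_E) ≃+ W(K̄_E)`, `Γ_E`-equivariant up to the local character
  set L : localPoints (V.quadraticTwist d) E ≃+ localPoints V E :=
    (show localPoints (V.quadraticTwist d) E ≃+ localPoints V E from
      (VariableChange.pointEquiv ((V.quadraticTwist d).baseChange (AlgebraicClosure E))
          ((untwist hd).map (closureEmb (K := K) E : AlgebraicClosure K →+* AlgebraicClosure E))).trans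
        (Affine.Point.congrEquiv (untwist_map_closureEmb_smul V hd E))) with hL
  have hLsome : ∀ (x y : AlgebraicClosure E)
      (h : ((V.quadraticTwist d).baseChange (AlgebraicClosure E)).toAffine.Nonsingular x y),
      ∃ h', L (show localPoints (V.quadraticTwist d) E from .some x y h) =
        (show localPoints V E from .some ((closureEmb (K := K) E (geomSqrt d) ^ 2)⁻¹ * x)
          ((closureEmb (K := K) E (geomSqrt d) ^ 3)⁻¹ * y) h') :=
    fun x y h ↦ localUntwist_some V hd E h
  set eL : localPoints Wd E ≃+ localPoints W E :=
    (((twistLocalIso E hWd).symm.trans (localPointsCongr E hVW)).trans L).trans (twistLocalIso E hV).symm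
    with heL
  have hloc : ∀ τ : absoluteGaloisGroup E, PrimeTwist.localChar χ E τ = χ' (resGal (K := K) E τ) := fun τ ↦ rfl
  have hfixL : ∀ (τ : absoluteGaloisGroup E) (Q : localPoints Wd E), PrimeTwist.localChar χ E τ = 1 →
      eL (τ • Q) = τ • eL Q := by
    intro τ Q hτ
    rw [hloc] at hτ
    have hfix : (show AlgebraicClosure E ≃ₐ[E] AlgebraicClosure E from τ) (closureEmb (K := K) E (geomSqrt d)) =
        closureEmb (K := K) E (geomSqrt d) := by
      rw [← closureEmb_resGal_smul_geomSqrt E τ, (hχ _).mp hτ]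
    simp only [heL, AddEquiv.trans_apply]
    rw [symm_equivariant (twistLocalIso E hWd) (twistLocalIso_smul E hWd) τ Q, localPointsCongr_smul,
      localUntwist_smul_of_fix V E L hLsome τ hfix,
      symm_equivariant (twistLocalIso E hV) (twistLocalIso_smul E hV) τ]
  have hnegL : ∀ (τ : absoluteGaloisGroup E) (Q : localPoints Wd E), PrimeTwist.localChar χ E τ ≠ 1 →
      eL (τ • Q) = -(τ • eL Q) := by
    intro τ Q hτ
    rw [hloc] at hτ
    have hneg : (show AlgebraicClosure E ≃ₐ[E] AlgebraicClosure E from τ) (closureEmb (K := K) E (geomSqrt d)) =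
        -closureEmb (K := K) E (geomSqrt d) := by
      rcases map_geomSqrt (absoluteGaloisGroup.toAlgEquiv K (resGal (K := K) E τ)) d with h | h
      · exact absurd ((hχ _).mpr h) hτ
      · rw [← closureEmb_resGal_smul_geomSqrt E τ, ← map_neg]
        exact congrArg (closureEmb (K := K) E) h
    simp only [heL, AddEquiv.trans_apply]
    rw [symm_equivariant (twistLocalIso E hWd) (twistLocalIso_smul E hWd) τ Q, localPointsCongr_smul,
      localUntwist_smul_of_neg V E L hLsome τ hneg, map_neg,
      symm_equivariant (twistLocalIso E hV) (twistLocalIso_smul E hV) τ]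
  obtain ⟨adL, hadL0, hadL1, -⟩ := exists_addEquiv_points_two (PrimeTwist.localChar χ E) (localPoints W E)
  set ΦE : localPoints Wd E ≃+ PrimeTwist.localModule W χ E := eL.trans adL with hΦEdef
  have hΦE : ∀ (τ : absoluteGaloisGroup E) (Q : localPoints Wd E), ΦE (τ • Q) = τ • ΦE Q := fun τ Q ↦
    addEquiv_points_two_smul_of_sign adL hadL0 hadL1 eL hfixL hnegL τ Q
  -- the square over `K̄` / `K̄_E`: `ι_* ∘ eG = eL ∘ ι_*`
  have hsqP : ∀ P : geomPoints Wd, pointsMap W E (eG P) = eL (pointsMap Wd E P) := fun P ↦ by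
    simp only [heG, heL, AddEquiv.trans_apply]
    rw [pointsMap_twistPointsIso_symm hV E, pointsMap_untwistEquiv V hd E L hLsome,
      pointsMap_geomPointsCongr E hVW, pointsMap_twistPointsIso_symm hWd E]
  refine ⟨fun x ↦ ?_, fun c ↦ ?_⟩
  · -- (i) the `2`-Selmer local condition of `Wd` ↔ the `𝔓`-Selmer local condition of `A_χ`
    have hsq : ∀ t : geomTorsion Wd ((2 : ℕ) : ℤ),
        ((PrimeTwist.locMap W χ E).comp (PrimeTwist.constEmb χ' W.geomPoints)) (ψ t) =
          ΦE (((pointsMap Wd E).comp (geomTorsion Wd ((2 : ℕ) : ℤ)).subtype) t) := by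
      intro t
      apply Subtype.ext
      ext i
      simp only [AddMonoidHom.coe_comp, Function.comp_apply, AddSubgroup.coe_subtype, PrimeTwist.locMap,
        PrimeTwist.pushforward_apply, PrimeTwist.constEmb_apply]
      rw [hψe t]
      rcases zmod_two_cases i with rfl | rfl
      · rw [show ((ΦE (pointsMap Wd E (t : geomPoints Wd)) : PrimeTwist.localModule W χ E) :
            PrimeTwist.ResPoints (PrimeTwist.localChar χ E) (localPoints W E)) 0 = eL (pointsMap Wd E (t : geomPoints Wd))
            from hadL0 _, hsqP]
      · rw [show ((ΦE (pointsMap Wd E (t : geomPoints Wd)) : PrimeTwist.localModule W χ E) :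
            PrimeTwist.ResPoints (PrimeTwist.localChar χ E) (localPoints W E)) 1 = -(eL (pointsMap Wd E (t : geomPoints Wd)))
            from hadL1 _, ← hsqP, ← map_neg, hneg2 t]
    exact mem_resKer_iff_h1Equiv_mem (resGal (K := K) E)
      ((pointsMap Wd E).comp (geomTorsion Wd ((2 : ℕ) : ℤ)).subtype)
      (fun σ P ↦ by
        simp only [AddMonoidHom.coe_comp, AddSubgroup.coe_subtype, Function.comp_apply,
          Literature.NumberTheory.EllipticCurves.AddSubgroup.torsionBy.coe_smul]
        exact pointsMap_smul Wd E σ P)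
      ((PrimeTwist.locMap W χ E).comp (PrimeTwist.constEmb χ' W.geomPoints))
      (fun τ P ↦ by
        rw [AddMonoidHom.comp_apply, AddMonoidHom.comp_apply, PrimeTwist.constEmb_smul, PrimeTwist.locMap_smul])
      ψ hψ ΦE hΦE hsq x
  · -- (ii) the local kernels of `H¹(K, Wd)` and `H¹(K, A_χ)` at `E`
    have hsq : ∀ P : geomPoints Wd, (PrimeTwist.locMap W χ E) (Φ P) = ΦE (pointsMap Wd E P) := by
      intro P
      apply Subtype.ext
      ext i
      simp only [PrimeTwist.locMap, PrimeTwist.pushforward_apply]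
      rcases zmod_two_cases i with rfl | rfl
      · rw [show ((Φ P : PrimeTwist.geomModule W χ) : PrimeTwist.ResPoints χ' W.geomPoints) 0 = eG P from hadG0 _,
          show ((ΦE (pointsMap Wd E P) : PrimeTwist.localModule W χ E) :
            PrimeTwist.ResPoints (PrimeTwist.localChar χ E) (localPoints W E)) 0 = eL (pointsMap Wd E P) from hadL0 _, hsqP]
      · rw [show ((Φ P : PrimeTwist.geomModule W χ) : PrimeTwist.ResPoints χ' W.geomPoints) 1 = -(eG P) from hadG1 _,
          show ((ΦE (pointsMap Wd E P) : PrimeTwist.localModule W χ E) :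
            PrimeTwist.ResPoints (PrimeTwist.localChar χ E) (localPoints W E)) 1 = -(eL (pointsMap Wd E P)) from hadL1 _,
          map_neg, hsqP]
    exact mem_resKer_iff_h1Equiv_mem (resGal (K := K) E) (pointsMap Wd E) (pointsMap_smul Wd E)
      (PrimeTwist.locMap W χ E) (PrimeTwist.locMap_smul W χ E) Φ hΦ ΦE hΦE hsq c

end Main

end Summit.BirchSwinnertonDyer.BirchSwinnertonDyer.Theorems.GenusKolyArch

end
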